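import Summits.BirchSwinnertonDyer.Rank1Residual.Additive.X4SharpThreeKimShaLength
import Summits.BirchSwinnertonDyer.Rank1Residual.Additive.X4SharpThreeKimPartialBridge
import Summits.BirchSwinnertonDyer.Rank1Residual.Additive.X4SharpThreeKimShapeConsequences
import Summits.BirchSwinnertonDyer.Rank1Residual.X4.KimTamagawaDefect
import Summits.BirchSwinnertonDyer.Rank1Residual.X4.KimShaLengthFiveLe
import Summits.BirchSwinnertonDyer.Rank1Residual.Additive.X4KimLargeImageIntegralPeriod
import Literature.NumberTheory.EllipticCurves.Kim2026.ShaLengthRankZeroKuriharaDivisibilityBound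
import HarnessLib

/-!
# The IMPLICATION LATTICE of the Kim-at-3 conjecture `Prop`s, rank `0` side: the missing named edges
# (team n1011, OWNERS row T-a2 / lead ruling R3-21·R4-10 "§(η) implication lattice"; seat p03;
# sibling `X4SharpThreeKimLatticeRankOne.lean` = the rank-`1` side)

HONEST FRAMING (cell `b2b-bsdres`, run/shared/lean/b2b/bsd-rank1-residual/, verbatim in every
file): the goal of the cell is to DELETE the COMBINATION-SHAPED residual classes of the
Birch–Swinnerton-Dyer formula for ALL analytic-rank `≤ 1` elliptic curves over `ℚ` — "full BSD
formula for every rank `≤ 1` curve in class `C`" assembled STRICTLY from published theorems — so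
that the rank-`≤ 1` remainder becomes exactly the CONSTRUCTION-SHAPED classes, which are TYPED
(missing-input `Prop`s), NOT attempted. This is not "finishing BSD". Research routes; no claim beyond
stated classes; census output = EVIDENCE / conjecture items, never a Literature fact; nothing below
is booked; the label X4 and the mark of RESIDUAL-MAP §I N11 are UNCHANGED by this file. NOTHING is
asserted and NO new `Prop` is introduced: every theorem below is an implication or equivalence
between `Prop`s ALREADY in the tree (bookkeeping), or between such a `Prop` and a published /
announced named fact taken as an explicit hypothesis.

## What this file proves (cells/n1011/KIM-AT-3-ANATOMY.md §(η), the lattice table, cites these names)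

Team n1011 typed "Kim 2026 Thm. 1.8 (6) at `p = 3`" and Kim's refined Conjecture 1.10 at `3` as some
25 `@[conjecture] def`s across eight files (seats p03, p09, p11, p12, p17, cc-typer-1, additive-p4).
The lead's rule R3-21 — "no Kim-at-3 conjecture `Prop` without naming the `Prop` it refines + a bridge
theorem" — asks for the lattice of PROVED implications. Most edges are in the tree; this file adds
the edges that were only implicit (definitionally true but unnamed) or absent, rank `0` side:

* §1 PER PAIR, rank `0`: the `∂`-EXACT shape `KimRankZeroShaLengthAt` (cc-typer-1) is the TOP of the
  rank-`0` per-pair lattice — it implies the LOWER (level-`k`) and UPPER-divisibility shapes of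
  `X4SharpThreeKimRefined.lean` (named here; the proofs are `X4SharpThreeKimPartialBridge` §3), it is
  EQUIVALENT (odd `p`) to "the verbatim core `X4.KimShaLengthAt W p D.f` for every admissible datum"
  (cc-typer-1's bridge + additive-p4's converse), it follows at `p ≥ 3` from the announced [K25]
  Thm. 1.1 own-currency `_OPEN` record MODULO the `Ω⁺_f`-integrality of the plus symbols (the flag
  `Kim2025-OmegaE-integrality`, team row T-R18b), and the UPPER-divisibility shape is a THEOREM at
  `p ≥ 5` from harvest-2's published E67 fact (`kimRankZeroUpperDivBoundAt_of_five_le`, the missing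
  STEP-0 twin of `kimRankZeroLowerBoundAt_of_five_le`).
* §2 REFINED CONJECTURE: p03's `KimRefinedIndexLeAt/GeAt W p` (binder shape, `c_p` included) versus
  p12's binder-free `X4.KimTamagawaDefectLeAt/GeAt/At W p f`: `≤` halves EQUIVALENT datum by datum,
  `≥` half p03 ⟹ p12 (the converse is NOT formal: p03's universal divisibility ranges over the
  literal levels `𝒩_k`, p12's `∂^{(∞)}` over the cyclic ones), both ⟹ `KimTamagawaDefectAt`; and the
  printed Conjecture 1.10 (`X4.kim2026_conjecture_1_10`, `p ≥ 5`) ⟹ the `≤` half in binder shape.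
* §3 CLASS LEVEL at `3`: `X4SharpThreeKimShaLength ⟹ X4SharpThreeKimLower ∧ X4SharpThreeKimUpperDiv`,
  `X4SharpThreeKimLower ∧ X4SharpThreeKim ⟹ X4SharpThreeKimUnit`, `X4SharpUnitFree ⟹ X4SharpThree`
  (fact-free) `⟹ X4SharpThreeKim` (GZK, modularity), the refined class conjectures versus p12's
  predicates, and `KimThreeShaLength` / `X4SharpThreeKimShaLength` from the [K25] `_OPEN` record
  modulo integrality.

NON-EDGES recorded in §(η) (not provable as stated, by binder inspection): `KimRankZeroShaLengthAt ⟹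
KimRankZeroBoundAt` and `KimRankZeroUpperDivBoundAt ⟹ KimRankZeroBoundAt` (the inequality shape has
NO period-transfer binder — it quantifies over every datum with `p ∤ c_D`); `X4.KimTamagawaDefectGeAt
⟹ KimRefinedIndexGeAt` (cyclic vs literal levels); `KimRankZeroShaLengthAt W p` at `p ≥ 5` from the
tree facts for NON-conductor-level data (additive-p4's discharge carries `W.conductorNorm ℤ = N`).

References: C.-H. Kim, Amer. J. Math. 148 (2026) = arXiv:2203.12159v4, Thm. 1.9 (6), Conj. 1.10,
§1.5.1 [Kim2022StructureSelmer]; C.-H. Kim (app. R. Pollack), arXiv:2505.09121v1 (2025, PREPRINT —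
ANNOUNCED, flag `Kim2025-preprint`) Thm. 1.1, Cor. 1.7 [Kim2025RefinedTNC]; R. Sakamoto, JTNB 36
(2024) Thm. 1.1 [Sakamoto2024KolyvaginThree]; Miller, LMS J. Comput. Math. 14 (2011) Def. 1.1
[Miller2011LMS]; cell files cells/n1011/KIM-AT-3-ANATOMY.md §(η), cells/n1011/OWNERS.md (T-a2,
T-a4, T-N10C, T-a2r1b, T-R18b), cells/n1011/PLAN.md R3-21 / R4-10.
-/

noncomputable section

open scoped Classical MatrixGroups ModularForm

open CongruenceSubgroup WeierstrassCurve Literature.NumberTheory.EllipticCurves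
  Literature.NumberTheory.EllipticCurves.ModularForms
  Literature.NumberTheory.EllipticCurves.Rank1Residual
  Literature.NumberTheory.EllipticCurves.Rank1Residual.Typed

namespace Summit.BirchSwinnertonDyer.Rank1Residual.Additive

open Summit.BirchSwinnertonDyer.Rank1Residual.X4

/-! ## §1 Per pair, analytic rank `0`: the `∂`-exact shape is the top of the lattice -/

section PerPairRankZero

variable (W : WeierstrassCurve ℚ) [W.IsElliptic] [W.IsGloballyMinimal] (p : ℕ) [Fact p.Prime]

/-- **`KimRankZeroShaLengthAt ⟹ KimRankZeroLowerBoundAt`** (any `p`): the `∂`-exact shape of clause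
(6) gives the LOWER direction at every level `k` (a witness `δ̃_n^{(k)} ≠ 0` at a cyclic level forces
`∂^{(∞)} ≤ k − 1`). Named edge; the proof is `kimRankZeroLowerBoundAt_of_kimShaLengthRankZeroAt`
(`X4SharpThreeKimPartialBridge` §3), whose hypothesis is this `Prop` unfolded.
[cite: Kim2022StructureSelmer, Thm. 1.9 (6) (PDF p. 8), §1.5.1 (PDF p. 7)] -/
theorem kimRankZeroLowerBoundAt_of_kimRankZeroShaLengthAt (h : KimRankZeroShaLengthAt W p) :
    KimRankZeroLowerBoundAt W p :=
  kimRankZeroLowerBoundAt_of_kimShaLengthRankZeroAt W p h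

/-- **`KimRankZeroShaLengthAt ⟹ KimRankZeroUpperDivBoundAt`** (any `p`): the `∂`-exact shape gives
the UPPER direction with every divisibility exponent `m` (universal divisibility by `p^{min(m,k)}`
forces `m ≤ ∂^{(∞)}`). Named edge over `kimRankZeroUpperDivBoundAt_of_kimShaLengthRankZeroAt`.
[cite: Kim2022StructureSelmer, Thm. 1.9 (6) (PDF p. 8), §1.5.1 (PDF p. 7)] -/
theorem kimRankZeroUpperDivBoundAt_of_kimRankZeroShaLengthAt (h : KimRankZeroShaLengthAt W p) :
    KimRankZeroUpperDivBoundAt W p :=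
  kimRankZeroUpperDivBoundAt_of_kimShaLengthRankZeroAt W p h

/-- **`KimRankZeroShaLengthAt W p ⟺ "the VERBATIM core `X4.KimShaLengthAt W p D.f` for every admissible
datum"** (`p` odd). Under the binders (surj(p) — so `E[p]` is irreducible and `[0]⁺_{D.f}` is
`p`-integral —, tower, `L(E,1) ≠ 0`, `Ш` finite, `D` with `p ∤ c_D`, period transfer) the BSD-currency
reading `X4.KimShaLengthRankZeroAt W p D.f` and the normalisation-internal core `X4.KimShaLengthAt W p D.f`
are equivalent: `⟸` is cc-typer-1's `X4.kimShaLengthRankZeroAt_of_kimShaLengthAt`, `⟹` is additive-p4's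
`X4.kimShaLengthAt_of_kimShaLengthRankZeroAt` (`ord(δ̃) = 0`, only `r = 0` occurs). So the verbatim
core, quantified over the admissible data, is the SAME node as the `∂`-exact binder shape.
[cite: Kim2022StructureSelmer, Thm. 1.9 (6) (PDF p. 8), §1.4.3–1.4.4 and §1.5.1 (PDF p. 7)] -/
theorem kimRankZeroShaLengthAt_iff_forall_kimShaLengthAt (hp2 : p ≠ 2) :
    KimRankZeroShaLengthAt W p ↔
      (W.HasSurjectiveModNGaloisRep p → (∀ n : ℕ, W.HasSurjectiveModNGaloisRep (p ^ n : ℕ)) →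
        W.entireLFunction 1 ≠ 0 → Finite W.sha →
        ∀ {N : ℕ} [NeZero N] (D : ModularParametrizationData W N), ¬ (p : ℤ) ∣ D.maninConstant →
        (∃ u : ℚ, ‖(u : ℚ_[p])‖ = 1 ∧ W.realPeriodRat = u * plusPeriod D.f) →
        KimShaLengthAt W p D.f) := by
  constructor
  · intro h hs ht hL hfin N _ D hc hper
    exact kimShaLengthAt_of_kimShaLengthRankZeroAt W p hp2
      (hasIrreducibleModPGaloisRep_of_hasSurjectiveModNGaloisRep W p hs) hL D hper
      (h hs ht hL hfin D hc hper)
  · intro h hs ht hL hfin N _ D hc hper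
    exact kimShaLengthRankZeroAt_of_kimShaLengthAt W p hp2
      (hasIrreducibleModPGaloisRep_of_hasSurjectiveModNGaloisRep W p hs) hL D hper
      (h hs ht hL hfin D hc hper)

/-- **STEP-0 in the kernel (UPPER-divisibility shape): at `5 ≤ p` the per-pair predicate
`KimRankZeroUpperDivBoundAt W p` IS harvest-2's published E67 fact** `hE67 =
Kim2026.rankZero_padicValNat_sha_add_le_of_forall_pow_dvd_kuriharaNumber` (Kim 2026 Thm. 1.9 (6), UPPER
direction with exponent `m`, literal levels `𝒩_k`; the tower binder is not used; binder order
`∀ k, 1 ≤ k → ∀ n` of the fact vs `∀ k n, 1 ≤ k →` of the predicate). The missing twin of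
`kimRankZeroBoundAt_of_five_le` / `kimRankZeroLowerBoundAt_of_five_le` (flag of the fact inherited:
`Kim-(6)-partial-reading`). [cite: Kim2022StructureSelmer, Thm. 1.9 (6) (PDF p. 8), §1.5.1 (PDF p. 7)] -/
theorem kimRankZeroUpperDivBoundAt_of_five_le
    (hE67 : Kim2026.rankZero_padicValNat_sha_add_le_of_forall_pow_dvd_kuriharaNumber) (hp : 5 ≤ p) :
    KimRankZeroUpperDivBoundAt W p :=
  fun hsurj _ hL hfin _ _ D hc hper m hdvd =>
    hE67 W p hp hsurj hL hfin D hc hper m fun k hk n _ hn ψ hψ => hdvd k n hk hn ψ hψ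

/-- **[K25] Thm. 1.1 ("BSD") own-currency `_OPEN` record ⟹ `KimRankZeroShaLengthAt W p` at `p ≥ 3`,
MODULO the `Ω⁺_f`-INTEGRALITY of the plus symbols of every admissible datum** (`hint`: for every `D`
with `p ∤ c_D`, `0 ≤ ord_p [r]⁺_{D.f}` whenever `[r]⁺_{D.f} ≠ 0` — Kim AJM 148 §1.4.1's standing claim
under large image and `p ∤ c_D`; in the tree a THEOREM only for `den r` coprime to the level
(`IsNewformOf.norm_ratPlusSymbol_le_one`), the all-cusps half is team row T-R18b; flag
`Kim2025-OmegaE-integrality`). One line over p09's `kimShaLengthRankZeroAt_of_kim2025_OPEN`.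
CONDITIONAL on the preprint (`hK25s`, ANNOUNCED, never a theorem of the tree).
[claim: Kim2025RefinedTNC, status: under-review]
[cite: Kim2025RefinedTNC, Thm. 1.1 ("BSD"), Cor. 1.7, §1.4.4 (ANNOUNCED preprint — the reason, not a source of truth)]
[cite: Kim2022StructureSelmer, §1.4.1 (PDF p. 7)] -/
theorem kimRankZeroShaLengthAt_of_kim2025_OPEN_of_integral
    (hK25s : Kim2025.thm11_kimShaLength_of_integralPeriod_OPEN) (hp3 : 3 ≤ p)
    (hint : ∀ {N : ℕ} [NeZero N] (D : ModularParametrizationData W N), ¬ (p : ℤ) ∣ D.maninConstant →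
      ∀ r : ℚ, ratPlusSymbol D.f r ≠ 0 → 0 ≤ padicValRat p (ratPlusSymbol D.f r)) :
    KimRankZeroShaLengthAt W p :=
  fun _ ht hL hfin _ _ D hc hper =>
    kimShaLengthRankZeroAt_of_kim2025_OPEN W p hK25s hp3 ht hL hfin D hper (hint D hc)

end PerPairRankZero

/-! ## §2 The refined conjecture: p03's binder shapes versus p12's `∂`-predicates -/

section Refined

variable (W : WeierstrassCurve ℚ) [W.IsElliptic] [W.IsGloballyMinimal] (p : ℕ) [Fact p.Prime]

omit [W.IsElliptic] [Fact p.Prime] in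
/-- **p12's `X4.KimTamagawaDefectLeAt W p f` IS p03's certificate predicate
`KuriharaIndexLeAt W p f (ord_p ∏ c_ℓ)`** (`∂^{(∞)}(δ̃_f) ≤ ord_p ∏_ℓ c_ℓ(E)` ⟺ some cyclic-level
Kurihara number of `f` has divisibility index `≤ ord_p ∏ c_ℓ`). Named edge over
`kuriharaIndexLeAt_iff_kuriharaPartialInfty_le`. [cite: Kim2022StructureSelmer, Conj. 1.10 (PDF p. 8), §1.5.1 (PDF p. 7)] -/
theorem kimTamagawaDefectLeAt_iff_kuriharaIndexLeAt {N : ℕ} [NeZero N] (f : CuspForm (Gamma0 N) 2) :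
    KimTamagawaDefectLeAt W p f ↔ KuriharaIndexLeAt W p f (padicValNat p W.tamagawaProduct) :=
  (kuriharaIndexLeAt_iff_kuriharaPartialInfty_le W p f _).symm

/-- **`KimRefinedIndexLeAt W p ⟺ X4.KimTamagawaDefectLeAt W p D.f` for every admissible datum** (under
the binders surj(p), tower, `L(E,1) ≠ 0`, `D` with `p ∤ c_D`, period transfer): the `≤` half of
Kim's Conjecture 1.10 at the pair, p03's existence shape (T-a2, census form A0, `c_p` included) and
p12's `∂`-predicate (T-N10C) are the SAME statement datum by datum. Named edge over
`kimRefinedIndexLeAt_iff_partialInfty_le`. [cite: Kim2022StructureSelmer, Conj. 1.10 (PDF p. 8), §1.5.1 (PDF p. 7)] -/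
theorem kimRefinedIndexLeAt_iff_forall_kimTamagawaDefectLeAt :
    KimRefinedIndexLeAt W p ↔
      (W.HasSurjectiveModNGaloisRep p → (∀ n : ℕ, W.HasSurjectiveModNGaloisRep (p ^ n : ℕ)) →
        W.entireLFunction 1 ≠ 0 →
        ∀ {N : ℕ} [NeZero N] (D : ModularParametrizationData W N), ¬ (p : ℤ) ∣ D.maninConstant →
        (∃ u : ℚ, ‖(u : ℚ_[p])‖ = 1 ∧ W.realPeriodRat = u * plusPeriod D.f) →
        KimTamagawaDefectLeAt W p D.f) :=
  kimRefinedIndexLeAt_iff_partialInfty_le W p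

/-- **`KimRefinedIndexGeAt W p ⟹ X4.KimTamagawaDefectGeAt W p D.f` for every admissible datum**: the
`≥` half in p03's universal-divisibility shape (literal levels `𝒩_k`) gives p12's `ord_p ∏ c_ℓ ≤
∂^{(∞)}(δ̃_{D.f})` (cyclic levels). The converse is NOT formal (a bound on the cyclic-level `∂^{(∞)}`
says nothing about the non-cyclic levels of `𝒩_k`). Named edge over
`le_partialInfty_of_kimRefinedIndexGeAt`. [cite: Kim2022StructureSelmer, Conj. 1.10 (PDF p. 8), §1.5.1 (PDF p. 7)] -/
theorem kimTamagawaDefectGeAt_of_kimRefinedIndexGeAt (h : KimRefinedIndexGeAt W p)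
    (hs : W.HasSurjectiveModNGaloisRep p) (ht : ∀ n : ℕ, W.HasSurjectiveModNGaloisRep (p ^ n : ℕ))
    (hL : W.entireLFunction 1 ≠ 0)
    {N : ℕ} [NeZero N] (D : ModularParametrizationData W N) (hc : ¬ (p : ℤ) ∣ D.maninConstant)
    (hper : ∃ u : ℚ, ‖(u : ℚ_[p])‖ = 1 ∧ W.realPeriodRat = u * plusPeriod D.f) :
    KimTamagawaDefectGeAt W p D.f :=
  le_partialInfty_of_kimRefinedIndexGeAt W p h hs ht hL D hc hper

/-- **Both refined halves in p03's shape ⟹ p12's `X4.KimTamagawaDefectAt W p D.f`** (Kim's Conjecture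
1.10 verbatim at the pair, `∂^{(∞)}(δ̃_{D.f}) = ord_p ∏_ℓ c_ℓ(E)`, cyclic-level `∂`, `c_p` included)
for every admissible datum. Named edge over `partialInfty_eq_tamagawa_of_kimRefined`.
[cite: Kim2022StructureSelmer, Conj. 1.10 (PDF p. 8)] -/
theorem kimTamagawaDefectAt_of_kimRefined (hle : KimRefinedIndexLeAt W p)
    (hge : KimRefinedIndexGeAt W p)
    (hs : W.HasSurjectiveModNGaloisRep p) (ht : ∀ n : ℕ, W.HasSurjectiveModNGaloisRep (p ^ n : ℕ))
    (hL : W.entireLFunction 1 ≠ 0)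
    {N : ℕ} [NeZero N] (D : ModularParametrizationData W N) (hc : ¬ (p : ℤ) ∣ D.maninConstant)
    (hper : ∃ u : ℚ, ‖(u : ℚ_[p])‖ = 1 ∧ W.realPeriodRat = u * plusPeriod D.f) :
    KimTamagawaDefectAt W p D.f :=
  partialInfty_eq_tamagawa_of_kimRefined W p hle hge hs ht hL D hc hper

/-- **The PRINTED Conjecture 1.10 (`X4.kim2026_conjecture_1_10`: `p ≥ 5`, surj(p), datum with `p ∤ c_D`,
period transfer ⟹ `KimTamagawaDefectAt`, no rank binder) ⟹ p03's `≤` half `KimRefinedIndexLeAt W p`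
at every `p ≥ 5`** (the binder shape asks for MORE hypotheses — tower, `L(E,1) ≠ 0` — and concludes
the `≤` half only). The `≥` half in p03's literal-level shape does NOT follow formally (cyclic vs
literal levels). [cite: Kim2022StructureSelmer, Conj. 1.10 (§1.5.3, PDF p. 8)] -/
theorem kimRefinedIndexLeAt_of_kim2026Conjecture_of_five_le (h : kim2026_conjecture_1_10)
    (hp : 5 ≤ p) : KimRefinedIndexLeAt W p :=
  (kimRefinedIndexLeAt_iff_forall_kimTamagawaDefectLeAt W p).mpr
    fun hs _ _ _ _ D hc hper => ((kimTamagawaDefectAt_iff W p D.f).mp (h W p hp hs D hc hper)).1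

end Refined

/-! ## §3 Class level at `p = 3` (rank `0`): the missing edges among the N11 conjectures -/

section ClassLevel

/-- **`X4SharpThreeKimShaLength ⟹ X4SharpThreeKimLower`** (the `∂`-exact N11 hypothesis gives the
LOWER-direction N11 hypothesis). Bookkeeping. [cite: Kim2022StructureSelmer, Thm. 1.9 (6) (PDF p. 8)] -/
theorem x4SharpThreeKimLower_of_x4SharpThreeKimShaLength (h : X4SharpThreeKimShaLength) :
    X4SharpThreeKimLower :=
  fun W _ _ hA => kimRankZeroLowerBoundAt_of_kimRankZeroShaLengthAt W 3 (h W hA)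

/-- **`X4SharpThreeKimShaLength ⟹ X4SharpThreeKimUpperDiv`**. Bookkeeping.
[cite: Kim2022StructureSelmer, Thm. 1.9 (6) (PDF p. 8)] -/
theorem x4SharpThreeKimUpperDiv_of_x4SharpThreeKimShaLength (h : X4SharpThreeKimShaLength) :
    X4SharpThreeKimUpperDiv :=
  fun W _ _ hA => kimRankZeroUpperDivBoundAt_of_kimRankZeroShaLengthAt W 3 (h W hA)

/-- **`KimThreeShaLength ⟹ X4SharpThreeKimLower ∧ X4SharpThreeKimUpperDiv`** (through
`X4SharpThreeKimShaLength`). Bookkeeping. [cite: Kim2022StructureSelmer, Thm. 1.9 (6) (PDF p. 8)] -/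
theorem x4SharpThreeKimLower_and_upperDiv_of_kimThreeShaLength (h : KimThreeShaLength) :
    X4SharpThreeKimLower ∧ X4SharpThreeKimUpperDiv :=
  ⟨x4SharpThreeKimLower_of_x4SharpThreeKimShaLength (x4SharpThreeKimShaLength_of_kimThreeShaLength h),
    x4SharpThreeKimUpperDiv_of_x4SharpThreeKimShaLength (x4SharpThreeKimShaLength_of_kimThreeShaLength h)⟩

/-- **`X4SharpThreeKimLower ∧ X4SharpThreeKim ⟹ X4SharpThreeKimUnit`**: the LOWER shape at level
`k = 1` together with the certificate-free INEQUALITY shape is the unit/EQUALITY shape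
(`kimRankZeroUnitBoundAt_of_lower_of_bound`, per pair). Bookkeeping. [cite: Kim2022StructureSelmer, Thm. 1.9 (1) and (6) (PDF pp. 7–8)] -/
theorem x4SharpThreeKimUnit_of_x4SharpThreeKimLower_of_x4SharpThreeKim (hL : X4SharpThreeKimLower)
    (hK : X4SharpThreeKim) : X4SharpThreeKimUnit :=
  fun W _ _ hA => kimRankZeroUnitBoundAt_of_lower_of_bound W 3 (hL W hA) (hK W hA)

/-- **`KimThree ∧ X4SharpThreeKimLower ⟹ X4SharpThreeKimUnit`** (the every-curve inequality conjecture
restricted to the additive rows, plus LOWER). Bookkeeping. [cite: Kim2022StructureSelmer, Thm. 1.9 (1) and (6) (PDF pp. 7–8)] -/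
theorem x4SharpThreeKimUnit_of_kimThree_of_x4SharpThreeKimLower (hK : KimThree)
    (hL : X4SharpThreeKimLower) : X4SharpThreeKimUnit :=
  x4SharpThreeKimUnit_of_x4SharpThreeKimLower_of_x4SharpThreeKim hL (x4SharpThreeKim_of_kimThree hK)

/-- **`X4SharpUnitFree ⟹ X4SharpThree`** (fact-free): the data-suggested class statement
"`ord_p #Ш = ord_p #Ш_an` on every X4 ∧ `r_an = 0` ∧ surj(p) pair" (`Typed.MissingPPartAt W p`,
`#Ш_an = q ∈ ℚ` with `ord_p q = ord_p #Ш`) specialised to `p = 3` gives X4♯(3)'s inequality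
`ord₃ #Ш ≤ ord₃ q + ord₃ ∏ c_ℓ` for every datum (the Manin binder of X4♯(3) is not even used).
[cite: Miller2011LMS, Def. 1.1 (arXiv:1010.2431 p. 3)] -/
theorem x4SharpThree_of_x4SharpUnitFree (h : X4SharpUnitFree) : X4SharpThree := by
  intro W _ _ hr hX hs N _ D _
  haveI : Fact (Nat.Prime 3) := ⟨Nat.prime_three⟩
  obtain ⟨q, hq, hv⟩ := h W 3 hr hX hs
  refine ⟨q, hq, ?_⟩
  rw [hv]
  exact le_add_of_nonneg_right (by positivity)

/-- **`X4SharpUnitFree ⟹ X4SharpThreeKim`** (granted GZK `hGZK` and modularity `hmod`, which the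
binder-by-binder comparison `x4SharpThreeKim_iff_x4SharpThree_tower` uses to read `r_an = 0` as
`L(E,1) ≠ 0 ∧ Ш finite`). [cite: Miller2011LMS, Def. 1.1] [cite: Kim2022StructureSelmer, Thm. 1.9 (6) (PDF p. 8)] -/
theorem x4SharpThreeKim_of_x4SharpUnitFree
    (hGZK : rank_eq_analyticRank_of_analyticRank_le_one) (hmod : hasEntireLFunction_rat)
    (h : X4SharpUnitFree) : X4SharpThreeKim :=
  x4SharpThreeKim_of_x4SharpThree hGZK hmod (x4SharpThree_of_x4SharpUnitFree h)

/-- **`X4Sharp ⟹ X4SharpThreeKim`** (the class-wide X4♯ for `r_an ≤ 1`, through its rank-`0`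
surjective part `X4SharpUnitFree`). [cite: Miller2011LMS, Def. 1.1] -/
theorem x4SharpThreeKim_of_x4Sharp
    (hGZK : rank_eq_analyticRank_of_analyticRank_le_one) (hmod : hasEntireLFunction_rat)
    (h : X4Sharp) : X4SharpThreeKim :=
  x4SharpThreeKim_of_x4SharpUnitFree hGZK hmod (x4SharpUnitFree_and_rankOne_of_x4Sharp h).1

/-- **`X4SharpThreeRefinedLe ⟺ p12's `X4.KimTamagawaDefectLeAt W 3 D.f` on every N11 row and admissible
datum`** (T-a2's registered census conjecture A0, `≤` half, IS T-N10C's `≤`-predicate at `3` on the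
additive rows). [cite: Kim2022StructureSelmer, Conj. 1.10 (PDF p. 8)] -/
theorem x4SharpThreeRefinedLe_iff_forall_kimTamagawaDefectLeAt :
    X4SharpThreeRefinedLe ↔
      ∀ (W : WeierstrassCurve ℚ) [W.IsElliptic] [W.IsGloballyMinimal], Addv W 3 →
        haveI : Fact (Nat.Prime 3) := ⟨Nat.prime_three⟩
        W.HasSurjectiveModNGaloisRep 3 → (∀ n : ℕ, W.HasSurjectiveModNGaloisRep (3 ^ n : ℕ)) →
        W.entireLFunction 1 ≠ 0 →
        ∀ {N : ℕ} [NeZero N] (D : ModularParametrizationData W N), ¬ (3 : ℤ) ∣ D.maninConstant →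
        (∃ u : ℚ, ‖(u : ℚ_[3])‖ = 1 ∧ W.realPeriodRat = u * plusPeriod D.f) →
        KimTamagawaDefectLeAt W 3 D.f := by
  haveI : Fact (Nat.Prime 3) := ⟨Nat.prime_three⟩
  constructor
  · intro h W _ _ hA
    exact (kimRefinedIndexLeAt_iff_forall_kimTamagawaDefectLeAt W 3).mp (h W hA)
  · intro h W _ _ hA
    exact (kimRefinedIndexLeAt_iff_forall_kimTamagawaDefectLeAt W 3).mpr (h W hA)

/-- **`X4SharpThreeRefinedGe ⟹ p12's `X4.KimTamagawaDefectGeAt W 3 D.f`** on every N11 row and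
admissible datum (converse not formal: cyclic vs literal levels). [cite: Kim2022StructureSelmer, Conj. 1.10 (PDF p. 8)] -/
theorem kimTamagawaDefectGeAt_three_of_x4SharpThreeRefinedGe (h : X4SharpThreeRefinedGe)
    (W : WeierstrassCurve ℚ) [W.IsElliptic] [W.IsGloballyMinimal] (hA : Addv W 3)
    [Fact (Nat.Prime 3)]
    (hs : W.HasSurjectiveModNGaloisRep 3) (ht : ∀ n : ℕ, W.HasSurjectiveModNGaloisRep (3 ^ n : ℕ))
    (hL : W.entireLFunction 1 ≠ 0)
    {N : ℕ} [NeZero N] (D : ModularParametrizationData W N) (hc : ¬ (3 : ℤ) ∣ D.maninConstant)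
    (hper : ∃ u : ℚ, ‖(u : ℚ_[3])‖ = 1 ∧ W.realPeriodRat = u * plusPeriod D.f) :
    KimTamagawaDefectGeAt W 3 D.f :=
  kimTamagawaDefectGeAt_of_kimRefinedIndexGeAt W 3 (h W hA) hs ht hL D hc hper

/-- **[K25] Thm. 1.1 own-currency `_OPEN` ⟹ `KimThreeShaLength`, MODULO the `Ω⁺_f`-integrality of
every admissible datum of every curve** (`hint`; flag `Kim2025-OmegaE-integrality`, row T-R18b). With
the landed edges this puts the announced statement on top of the whole rank-`0` lattice at `3`:
`KimThreeShaLength ⟹ KimThreeUnit`, `⟹ X4SharpThreeKimShaLength ⟹ X4SharpThreeKim{Unit,Lower,UpperDiv}`.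
CONDITIONAL on the preprint. [claim: Kim2025RefinedTNC, status: under-review]
[cite: Kim2025RefinedTNC, Thm. 1.1 ("BSD"), Cor. 1.7 (ANNOUNCED preprint — the reason, not a source of truth)]
[cite: Sakamoto2024KolyvaginThree, Thm. 1.1] -/
theorem kimThreeShaLength_of_kim2025_OPEN_of_integral
    (hK25s : Kim2025.thm11_kimShaLength_of_integralPeriod_OPEN)
    (hint : ∀ (W : WeierstrassCurve ℚ) [W.IsElliptic] [W.IsGloballyMinimal]
      {N : ℕ} [NeZero N] (D : ModularParametrizationData W N), ¬ (3 : ℤ) ∣ D.maninConstant →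
      ∀ r : ℚ, ratPlusSymbol D.f r ≠ 0 → 0 ≤ padicValRat 3 (ratPlusSymbol D.f r)) :
    KimThreeShaLength :=
  fun W _ _ => kimRankZeroShaLengthAt_of_kim2025_OPEN_of_integral W 3 hK25s le_rfl
    (fun D hc => hint W D hc)

/-- **[K25] Thm. 1.1 own-currency `_OPEN` ⟹ `X4SharpThreeKimShaLength`** (the `∂`-exact N11
hypothesis), MODULO the integrality of the admissible data of the ADDITIVE rows only. CONDITIONAL on
the preprint. [claim: Kim2025RefinedTNC, status: under-review]
[cite: Kim2025RefinedTNC, Thm. 1.1 ("BSD"), Cor. 1.7 (ANNOUNCED preprint — the reason, not a source of truth)]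
[cite: Sakamoto2024KolyvaginThree, Thm. 1.1] -/
theorem x4SharpThreeKimShaLength_of_kim2025_OPEN_of_integral
    (hK25s : Kim2025.thm11_kimShaLength_of_integralPeriod_OPEN)
    (hint : ∀ (W : WeierstrassCurve ℚ) [W.IsElliptic] [W.IsGloballyMinimal], Addv W 3 →
      ∀ {N : ℕ} [NeZero N] (D : ModularParametrizationData W N), ¬ (3 : ℤ) ∣ D.maninConstant →
      ∀ r : ℚ, ratPlusSymbol D.f r ≠ 0 → 0 ≤ padicValRat 3 (ratPlusSymbol D.f r)) :
    X4SharpThreeKimShaLength :=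
  fun W _ _ hA => kimRankZeroShaLengthAt_of_kim2025_OPEN_of_integral W 3 hK25s le_rfl
    (fun D hc => hint W hA D hc)

end ClassLevel

end Summit.BirchSwinnertonDyer.Rank1Residual.Additive

end
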